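import Summits.HubbardSuperconductivity.HubbardSuperconductivity.Theorems.ThermalWedgeTwTipContinuationEdgeOrderBCSExpectations
import Summits.HubbardSuperconductivity.HubbardSuperconductivity.Theorems.ThermalWedgeTwTipContinuationEdgeOrderCoherenceFactors
import Summits.HubbardSuperconductivity.HubbardSuperconductivity.Theorems.ThermalWedgeTwTipContinuationEdgeOrderTorusTrig
import Literature.MathematicalPhysics.QuantumLattice.PatchPairOperator

/-!
# `TwTipContinuation` (stmt-HubbardSuperconductivity-1700), line `isogap-submodular-transport`,
# stub `stub_edgeOrder` — piece 3b(iv): the regularised d-wave BCS trial state and its energy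

The grand-canonical trial vector is the fixed-phase BCS product state `Ψ = Π_k (u_k + v_k b†_k)|0⟩`
over all Bloch pair levels of the torus with the REGULARISED d-wave coherence factors of
`…EdgeOrderCoherenceFactors` at chemical potential `μ` and gap parameter `D > 0`:
`ξ_k = ε_L(k) − μ`, `r_k = √(ξ_k² + D²ĝ_d(k)² + D⁴)`, `u_k = √((1+ξ_k/r_k)/2)`,
`v_k = sgn(ĝ_d(k)) √((1−ξ_k/r_k)/2)`. With `N̄ = Σ_k (1 − ξ_k/r_k) = ⟨N⟩` and
`S = Σ_k ĝ_d(k)²/(2r_k)` (the d-wave-weighted regularised Cooper sum):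
* `re⟨Ψ, TΨ⟩ = Σ_k ε_L(k)(1 − ξ_k/r_k)` (`T = hubbardTorus 2 L 1 0`, `L ≥ 3`), `re⟨Ψ,NΨ⟩ = N̄`,
  `‖NΨ − N̄Ψ‖² ≤ L²`, `Ψ` spin-balanced and normalised;
* `8 D² S² ≤ re⟨Ψ, Δ_dᴴΔ_d Ψ⟩` (`Δ_d = −2√2 Σ_k ĝ_d(k) b_k`);
* **energy**: `re⟨Ψ, (T − (c/L²)Δ_dᴴΔ_d)Ψ⟩ ≤ Σ_k 2min(ξ_k,0) + μN̄ − D²L²` as soon as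
  `S ≥ 2L²` and `4c S ≥ L²` (the BCS instability: pairing gain `8cD²S²/L²` beats the kinetic
  cost `D²(S + L²/2)`).
Bardeen–Cooper–Schrieffer 1957 §II–III; Leggett, *Quantum Liquids* (2006) §5.4. No definitions
(local notation for the literal coefficient functions and the product term).
-/

noncomputable section

namespace Summit.HubbardSuperconductivity.TwTipContinuation.IsogapTransport

open Matrix Finset
open Literature.MathematicalPhysics.QuantumLattice Literature.Probability.LatticeModels
open scoped ComplexOrder ComplexConjugate

variable {L : ℕ} [NeZero L]

/-- The regularised quasiparticle energy `r_k(μ,D)` (local notation). -/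
local notation "rE[" μ ", " D "] " k:max =>
  Real.sqrt ((torusBand _ k - μ) ^ 2 + D ^ 2 * dWaveGap k ^ 2 + D ^ 4)

/-- The coherence factor `u_k(μ,D)` at a momentum (local notation for the literal term). -/
local notation "uA[" μ ", " D "] " k:max => Real.sqrt ((1 + (torusBand _ k - μ) / rE[μ, D] k) / 2)

set_option quotPrecheck false in
/-- The coherence factor `v_k(μ,D)` at a momentum (local notation for the literal term). -/
local notation "vA[" μ ", " D "] " k:max =>
  ((if 0 ≤ dWaveGap k then 1 else -1) * Real.sqrt ((1 - (torusBand _ k - μ) / rE[μ, D] k) / 2))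

/-- The coherence factor `u(μ,D)` as a function on the momentum grid (local notation). -/
local notation "uF[" μ ", " D "]" => (fun k : TorusSite 2 _ => uA[μ, D] k)

set_option quotPrecheck false in
/-- The coherence factor `v(μ,D)` as a function on the momentum grid (local notation). -/
local notation "vF[" μ ", " D "]" => (fun k : TorusSite 2 _ => vA[μ, D] k)

/-- The Bogoliubov factor `u_k + v_k b†_k` (local notation for the literal matrix term). -/
local notation "bf[" u ", " v "] " k:max =>
  (((u k : ℝ) : ℂ) • (1 : Matrix (Finset (Orb (FermionTorus 2 _))) (Finset (Orb (FermionTorus 2 _))) ℂ) +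
    ((v k : ℝ) : ℂ) • (pairMode k)ᴴ)

/-- The BCS product vector (local notation for the literal term). -/
local notation "Ψ[" u ", " v "] " l:max =>
  (List.prod (List.map (fun k => bf[u, v] k) l) *ᵥ (vacuum : Fock (Orb (FermionTorus 2 _))))

section Coefficients

variable (μ : ℝ) {D : ℝ}

omit [NeZero L] in
/-- Normalisation of the trial coefficients: `u_k² + v_k² = 1`. [folklore] -/
theorem trial_huv (hD : 0 < D) : ∀ k : TorusSite 2 L, (uF[μ, D]) k ^ 2 + (vF[μ, D]) k ^ 2 = 1 :=
  fun k => cohU_sq_add_cohV_sq (torusBand L k - μ) (dWaveGap k) hD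

omit [NeZero L] in
/-- `2 v_k² = 1 − ξ_k/r_k`. [folklore] -/
theorem two_mul_vA_sq (hD : 0 < D) (k : TorusSite 2 L) :
    2 * (vA[μ, D] k) ^ 2 = 1 - (torusBand L k - μ) / rE[μ, D] k := by
  rw [cohV_sq (torusBand L k - μ) (dWaveGap k) hD]; ring

/-- `v_{−k} = v_k` (the band and the d-wave factor are even). [folklore] -/
theorem vA_neg (k : TorusSite 2 L) : vA[μ, D] (-k) = vA[μ, D] k := by
  simp only [torusBand_neg, dWaveGap_neg]

end Coefficients

section State

variable (μ : ℝ) {D : ℝ}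

/-- **The trial state is normalised.** [folklore] -/
theorem trial_norm (hD : 0 < D) :
    star (Ψ[uF[μ, D], vF[μ, D]] (Finset.univ : Finset (TorusSite 2 L)).toList) ⬝ᵥ
      Ψ[uF[μ, D], vF[μ, D]] (Finset.univ : Finset (TorusSite 2 L)).toList = 1 :=
  star_prodState_dotProduct_self _ _ (trial_huv μ hD) (Finset.nodup_toList _)

/-- **The trial state is spin-balanced.** [folklore] -/
theorem trial_mem_spinBalanced :
    Ψ[uF[μ, D], vF[μ, D]] (Finset.univ : Finset (TorusSite 2 L)).toList ∈ spinBalanced :=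
  prodState_mem_spinBalanced _ _ _

/-- **Mean particle number** `re⟨Ψ, NΨ⟩ = N̄ = Σ_k (1 − ξ_k/r_k)`. [folklore] -/
theorem trial_re_expect_totalNumber (hD : 0 < D) :
    (star (Ψ[uF[μ, D], vF[μ, D]] (Finset.univ : Finset (TorusSite 2 L)).toList) ⬝ᵥ
        (totalNumber *ᵥ Ψ[uF[μ, D], vF[μ, D]] (Finset.univ : Finset (TorusSite 2 L)).toList)).re =
      ∑ k : TorusSite 2 L, (1 - (torusBand L k - μ) / rE[μ, D] k) := by
  rw [expect_totalNumber_prodState _ _ (trial_huv μ hD), Complex.ofReal_re]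
  exact Finset.sum_congr rfl fun k _ => two_mul_vA_sq μ hD k

/-- The complex mean number equals the real `N̄` cast. [folklore] -/
theorem trial_expect_totalNumber (hD : 0 < D) :
    star (Ψ[uF[μ, D], vF[μ, D]] (Finset.univ : Finset (TorusSite 2 L)).toList) ⬝ᵥ
        (totalNumber *ᵥ Ψ[uF[μ, D], vF[μ, D]] (Finset.univ : Finset (TorusSite 2 L)).toList) =
      ((∑ k : TorusSite 2 L, (1 - (torusBand L k - μ) / rE[μ, D] k) : ℝ) : ℂ) := by
  rw [expect_totalNumber_prodState _ _ (trial_huv μ hD)]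
  congr 1
  exact Finset.sum_congr rfl fun k _ => two_mul_vA_sq μ hD k

/-- **Number variance** `‖NΨ − N̄Ψ‖² ≤ L²`. [folklore] -/
theorem trial_variance_le (hD : 0 < D) :
    (star (totalNumber *ᵥ Ψ[uF[μ, D], vF[μ, D]] (Finset.univ : Finset (TorusSite 2 L)).toList -
          ((∑ k : TorusSite 2 L, (1 - (torusBand L k - μ) / rE[μ, D] k) : ℝ) : ℂ) •
            Ψ[uF[μ, D], vF[μ, D]] (Finset.univ : Finset (TorusSite 2 L)).toList) ⬝ᵥ
        (totalNumber *ᵥ Ψ[uF[μ, D], vF[μ, D]] (Finset.univ : Finset (TorusSite 2 L)).toList -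
          ((∑ k : TorusSite 2 L, (1 - (torusBand L k - μ) / rE[μ, D] k) : ℝ) : ℂ) •
            Ψ[uF[μ, D], vF[μ, D]] (Finset.univ : Finset (TorusSite 2 L)).toList)).re ≤ (L : ℝ) ^ 2 := by
  have hN : (∑ k : TorusSite 2 L, (1 - (torusBand L k - μ) / rE[μ, D] k)) =
      ∑ k : TorusSite 2 L, 2 * (vF[μ, D]) k ^ 2 :=
    Finset.sum_congr rfl fun k _ => (two_mul_vA_sq μ hD k).symm
  rw [hN, variance_totalNumber_prodState _ _ (trial_huv μ hD), Complex.ofReal_re]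
  calc ∑ k : TorusSite 2 L, (4 * (vF[μ, D]) k ^ 2 - 4 * (vF[μ, D]) k ^ 4)
      ≤ ∑ _k : TorusSite 2 L, (1 : ℝ) := Finset.sum_le_sum fun k _ => fluctuation_le_one _ _ hD
    _ = (L : ℝ) ^ 2 := by
        rw [Finset.sum_const, Finset.card_univ, card_torusSite_two, nsmul_eq_mul, mul_one]; push_cast; ring

/-- **Kinetic energy** `re⟨Ψ, TΨ⟩ = Σ_k ε_L(k)(1 − ξ_k/r_k)` (`L ≥ 3`). [folklore] -/
theorem trial_re_expect_kinetic (hD : 0 < D) (hL : 3 ≤ L) :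
    (star (Ψ[uF[μ, D], vF[μ, D]] (Finset.univ : Finset (TorusSite 2 L)).toList) ⬝ᵥ
        (hubbardTorus 2 L 1 0 *ᵥ Ψ[uF[μ, D], vF[μ, D]] (Finset.univ : Finset (TorusSite 2 L)).toList)).re =
      ∑ k : TorusSite 2 L, torusBand L k * (1 - (torusBand L k - μ) / rE[μ, D] k) := by
  rw [hubbardTorus_zero_eq_sum_momentumNumber hL, expect_oneBody_prodState _ _ (trial_huv μ hD), Complex.ofReal_re]
  refine Finset.sum_congr rfl fun k _ => ?_
  rw [vA_neg μ k]
  linear_combination (torusBand L k) * two_mul_vA_sq μ hD k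

/-- `Δ_dᴴ Δ_d = 8 · BᴴB` with `B = pairOperator dWaveGap univ`. [folklore] -/
theorem pairIntensity_eq_smul_pairOperator_sq :
    (pairField dWaveFormFactor L)ᴴ * pairField dWaveFormFactor L =
      (8 : ℂ) • ((pairOperator dWaveGap (Finset.univ : Finset (TorusSite 2 L)))ᴴ *
        pairOperator dWaveGap (Finset.univ : Finset (TorusSite 2 L))) := by
  rw [pairField_dWave_eq_smul_pairOperator, conjTranspose_neg, conjTranspose_smul, neg_mul_neg, smul_mul_smul_comm,
    Complex.star_def, Complex.conj_ofReal, ← Complex.ofReal_mul,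
    show (2 * Real.sqrt 2) * (2 * Real.sqrt 2) = (8 : ℝ) by nlinarith [Real.mul_self_sqrt (show (0:ℝ) ≤ 2 by norm_num)]]
  norm_num

/-- **Pair intensity of the trial state**: `8 (D S)² ≤ re⟨Ψ, Δ_dᴴΔ_d Ψ⟩`, `S = Σ_k ĝ_d(k)²/(2r_k)`. [folklore] -/
theorem trial_re_expect_pairIntensity_ge (hD : 0 < D) :
    8 * (D * ∑ k : TorusSite 2 L, dWaveGap k ^ 2 / (2 * rE[μ, D] k)) ^ 2 ≤
      (star (Ψ[uF[μ, D], vF[μ, D]] (Finset.univ : Finset (TorusSite 2 L)).toList) ⬝ᵥ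
        (((pairField dWaveFormFactor L)ᴴ * pairField dWaveFormFactor L) *ᵥ
          Ψ[uF[μ, D], vF[μ, D]] (Finset.univ : Finset (TorusSite 2 L)).toList)).re := by
  rw [pairIntensity_eq_smul_pairOperator_sq, smul_mulVec, dotProduct_smul, smul_eq_mul,
    show (8 : ℂ) = ((8 : ℝ) : ℂ) by norm_num, Complex.re_ofReal_mul]
  refine mul_le_mul_of_nonneg_left ?_ (by norm_num)
  have hamp := sq_pairAmplitude_le_expect_pairOperator_sq (uF[μ, D] : TorusSite 2 L → ℝ) (vF[μ, D]) (trial_huv μ hD) dWaveGap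
  refine le_trans ?_ hamp
  have hterm : ∀ k : TorusSite 2 L, D * dWaveGap k ^ 2 / (2 * rE[μ, D] k) ≤
      dWaveGap k * (uF[μ, D]) k * (vF[μ, D]) k := fun k => pairing_ge (torusBand L k - μ) (dWaveGap k) hD
  have hsum : D * ∑ k : TorusSite 2 L, dWaveGap k ^ 2 / (2 * rE[μ, D] k) ≤
      ∑ k : TorusSite 2 L, dWaveGap k * (uF[μ, D]) k * (vF[μ, D]) k := by
    rw [Finset.mul_sum]
    exact Finset.sum_le_sum fun k _ => by rw [← mul_div_assoc]; exact hterm k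
  have hnn : 0 ≤ D * ∑ k : TorusSite 2 L, dWaveGap k ^ 2 / (2 * rE[μ, D] k) :=
    mul_nonneg hD.le (Finset.sum_nonneg fun k _ => div_nonneg (sq_nonneg _) (mul_nonneg zero_le_two (Real.sqrt_nonneg _)))
  exact pow_le_pow_left₀ hnn hsum 2

/-- **Kinetic energy of the trial state versus the free Fermi sea (chemical-potential form)**:
`re⟨Ψ, TΨ⟩ ≤ Σ_k 2min(ξ_k, 0) + μN̄ + D² S + D² L²/2`, `S = Σ_k ĝ_d(k)²/(2r_k)`. [folklore] -/
theorem trial_re_expect_kinetic_le (hD : 0 < D) (hL : 3 ≤ L) :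
    (star (Ψ[uF[μ, D], vF[μ, D]] (Finset.univ : Finset (TorusSite 2 L)).toList) ⬝ᵥ
        (hubbardTorus 2 L 1 0 *ᵥ Ψ[uF[μ, D], vF[μ, D]] (Finset.univ : Finset (TorusSite 2 L)).toList)).re ≤
      ∑ k : TorusSite 2 L, 2 * min (torusBand L k - μ) 0 +
        μ * ∑ k : TorusSite 2 L, (1 - (torusBand L k - μ) / rE[μ, D] k) +
        D ^ 2 * ∑ k : TorusSite 2 L, dWaveGap k ^ 2 / (2 * rE[μ, D] k) + D ^ 2 * (L : ℝ) ^ 2 / 2 := by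
  rw [trial_re_expect_kinetic μ hD hL]
  have hterm : ∀ k : TorusSite 2 L, torusBand L k * (1 - (torusBand L k - μ) / rE[μ, D] k) ≤
      2 * min (torusBand L k - μ) 0 + μ * (1 - (torusBand L k - μ) / rE[μ, D] k) +
        D ^ 2 * (dWaveGap k ^ 2 / (2 * rE[μ, D] k)) + D ^ 2 / 2 := by
    intro k
    have hkin := kinetic_excess_le (torusBand L k - μ) (dWaveGap k) hD
    have hrpos := regE_pos (torusBand L k - μ) (dWaveGap k) hD
    have hrD := sq_le_regE (torusBand L k - μ) (dWaveGap k) D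
    -- `D⁴/(2r) ≤ D²/2`
    have hD4 : D ^ 4 / (2 * rE[μ, D] k) ≤ D ^ 2 / 2 := by
      rw [div_le_div_iff₀ (by positivity) (by norm_num)]
      nlinarith [sq_nonneg D]
    have hsplit : (D ^ 2 * dWaveGap k ^ 2 + D ^ 4) / (4 * rE[μ, D] k) =
        (D ^ 2 * (dWaveGap k ^ 2 / (2 * rE[μ, D] k)) + D ^ 4 / (2 * rE[μ, D] k)) / 2 := by
      field_simp
      ring
    rw [hsplit] at hkin
    have e : torusBand L k * (1 - (torusBand L k - μ) / rE[μ, D] k) =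
        2 * ((torusBand L k - μ) * ((1 - (torusBand L k - μ) / rE[μ, D] k) / 2)) +
          μ * (1 - (torusBand L k - μ) / rE[μ, D] k) := by ring
    rw [e]
    linarith
  calc ∑ k : TorusSite 2 L, torusBand L k * (1 - (torusBand L k - μ) / rE[μ, D] k)
      ≤ ∑ k : TorusSite 2 L, (2 * min (torusBand L k - μ) 0 + μ * (1 - (torusBand L k - μ) / rE[μ, D] k) +
          D ^ 2 * (dWaveGap k ^ 2 / (2 * rE[μ, D] k)) + D ^ 2 / 2) := Finset.sum_le_sum fun k _ => hterm k
    _ = _ := by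
        rw [Finset.mul_sum, Finset.mul_sum, Finset.sum_add_distrib, Finset.sum_add_distrib, Finset.sum_add_distrib,
          Finset.sum_const, Finset.card_univ, card_torusSite_two, nsmul_eq_mul]
        push_cast
        ring

/-- **The BCS instability of the free torus (piece 3b(iv) of `stub_edgeOrder`).** If the
regularised d-wave Cooper sum `S = Σ_k ĝ_d(k)²/(2r_k)` satisfies `S ≥ 2L²` and `4cS ≥ L²`, then
the regularised BCS trial state at `(μ, D)` has
`re⟨Ψ, (T − (c/L²) Δ_dᴴΔ_d) Ψ⟩ ≤ Σ_k 2min(ξ_k,0) + μN̄ − D²L²`. [folklore] -/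
theorem trial_energy_le (hD : 0 < D) (hL : 3 ≤ L) {c : ℝ} (hc : 0 ≤ c)
    (hS1 : 2 * (L : ℝ) ^ 2 ≤ ∑ k : TorusSite 2 L, dWaveGap k ^ 2 / (2 * rE[μ, D] k))
    (hS2 : (L : ℝ) ^ 2 ≤ 4 * c * ∑ k : TorusSite 2 L, dWaveGap k ^ 2 / (2 * rE[μ, D] k)) :
    (star (Ψ[uF[μ, D], vF[μ, D]] (Finset.univ : Finset (TorusSite 2 L)).toList) ⬝ᵥ
        ((hubbardTorus 2 L 1 0 - ((c / (L : ℝ) ^ 2 : ℝ) : ℂ) • ((pairField dWaveFormFactor L)ᴴ * pairField dWaveFormFactor L)) *ᵥ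
          Ψ[uF[μ, D], vF[μ, D]] (Finset.univ : Finset (TorusSite 2 L)).toList)).re ≤
      ∑ k : TorusSite 2 L, 2 * min (torusBand L k - μ) 0 +
        μ * ∑ k : TorusSite 2 L, (1 - (torusBand L k - μ) / rE[μ, D] k) - D ^ 2 * (L : ℝ) ^ 2 := by
  have hLpos : (0 : ℝ) < L := by exact_mod_cast (show 0 < L by omega)
  have hL2 : (0 : ℝ) < (L : ℝ) ^ 2 := by positivity
  set S := ∑ k : TorusSite 2 L, dWaveGap k ^ 2 / (2 * rE[μ, D] k) with hS
  have hkin := trial_re_expect_kinetic_le μ hD hL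
  have hpair := trial_re_expect_pairIntensity_ge (L := L) μ hD
  rw [← hS] at hkin hpair
  rw [sub_mulVec, dotProduct_sub, Complex.sub_re, smul_mulVec, dotProduct_smul, smul_eq_mul, Complex.re_ofReal_mul]
  -- the real inequality `D²(S + L²/2) − (c/L²)·8D²S² ≤ −D²L²`
  have hgain : D ^ 2 * S + D ^ 2 * (L : ℝ) ^ 2 / 2 - c / (L : ℝ) ^ 2 * (8 * (D * S) ^ 2) ≤ -(D ^ 2 * (L : ℝ) ^ 2) := by
    have h1 : (S + 3 * (L : ℝ) ^ 2 / 2) * (L : ℝ) ^ 2 ≤ 8 * c * S ^ 2 := by nlinarith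
    have h2 : c / (L : ℝ) ^ 2 * (8 * (D * S) ^ 2) = D ^ 2 * (8 * c * S ^ 2) / (L : ℝ) ^ 2 := by
      field_simp
    rw [h2]
    have h3 : D ^ 2 * ((S + 3 * (L : ℝ) ^ 2 / 2) * (L : ℝ) ^ 2) / (L : ℝ) ^ 2 ≤ D ^ 2 * (8 * c * S ^ 2) / (L : ℝ) ^ 2 := by
      gcongr
    have h4 : D ^ 2 * ((S + 3 * (L : ℝ) ^ 2 / 2) * (L : ℝ) ^ 2) / (L : ℝ) ^ 2 = D ^ 2 * (S + 3 * (L : ℝ) ^ 2 / 2) := by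
      field_simp
    rw [h4] at h3
    nlinarith
  have hγ : 0 ≤ c / (L : ℝ) ^ 2 := by positivity
  nlinarith [mul_le_mul_of_nonneg_left hpair hγ]

end State

/-- **The BCS instability of the free torus (piece 3b(iv) of `stub_edgeOrder`)**, closed form on the
literal trial vector. [folklore] -/
theorem bcsTrial_energy :
    ∀ (L : ℕ) [NeZero L] (μ D : ℝ), 0 < D → 3 ≤ L → ∀ (c : ℝ), 0 ≤ c → 2 * (L : ℝ) ^ 2 ≤ ∑ k : TorusSite 2 L, dWaveGap k ^ 2 / (2 * Real.sqrt ((torusBand L k - μ) ^ 2 + D ^ 2 * dWaveGap k ^ 2 + D ^ 4)) → (L : ℝ) ^ 2 ≤ 4 * c * ∑ k : TorusSite 2 L, dWaveGap k ^ 2 / (2 * Real.sqrt ((torusBand L k - μ) ^ 2 + D ^ 2 * dWaveGap k ^ 2 + D ^ 4)) → (star ((List.map (fun k => ((Real.sqrt ((1 + (torusBand L k - μ) / Real.sqrt ((torusBand L k - μ) ^ 2 + D ^ 2 * dWaveGap k ^ 2 + D ^ 4)) / 2) : ℝ) : ℂ) • (1 : Matrix (Finset (Orb (FermionTorus 2 L)))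 (Finset (Orb (FermionTorus 2 L))) ℂ) + (((if 0 ≤ dWaveGap k then 1 else -1) * Real.sqrt ((1 - (torusBand L k - μ) / Real.sqrt ((torusBand L k - μ) ^ 2 + D ^ 2 * dWaveGap k ^ 2 + D ^ 4)) / 2) : ℝ) : ℂ) • (pairMode k)ᴴ) (Finset.univ : Finset (TorusSite 2 L)).toList).prod *ᵥ (vacuum : Fock (Orb (FermionTorus 2 L)))) ⬝ᵥ ((hubbardTorus 2 L 1 0 - ((c / (L : ℝ) ^ 2 : ℝ) : ℂ) • ((pairField dWaveFormFactor L)ᴴ * pairField dWaveFormFactor L)) *ᵥ ((List.map (fun k => ((Real.sqrt ((1 + (torusBand L k - μ) / Real.sqrt ((torusBand L k - μ) ^ 2 + D ^ 2 * dWaveGap k ^ 2 + D ^ 4)) / 2) : ℝ) : ℂ) • (1 : Matrix (Finset (Orb (FermionTorus 2 L))) (Finset (Orb (FermionTorus 2 L))) ℂ) + (((if 0 ≤ dWaveGap k then 1 else -1) * Real.sqrt ((1 - (torusBand L k - μ) / Real.sqrt ((torusBand L k - μ) ^ 2 + D ^ 2 * dWaveGap k ^ 2 + D ^ 4)) / 2)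 : ℝ) : ℂ) • (pairMode k)ᴴ) (Finset.univ : Finset (TorusSite 2 L)).toList).prod *ᵥ (vacuum : Fock (Orb (FermionTorus 2 L)))))).re ≤ ∑ k : TorusSite 2 L, 2 * min (torusBand L k - μ) 0 + μ * ∑ k : TorusSite 2 L, (1 - (torusBand L k - μ) / Real.sqrt ((torusBand L k - μ) ^ 2 + D ^ 2 * dWaveGap k ^ 2 + D ^ 4)) - D ^ 2 * (L : ℝ) ^ 2 :=
  fun _ _ μ _ hD hL _ hc hS1 hS2 => trial_energy_le μ hD hL hc hS1 hS2

end Summit.HubbardSuperconductivity.TwTipContinuation.IsogapTransport
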